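import Literature.Geometry.Lorentzian.CauchyDevelopment
import Literature.Geometry.Lorentzian.SpacetimeReverse
import Literature.Geometry.Lorentzian.CauchyHypersurfaceCausalProofs
import Literature.Geometry.Lorentzian.NullInwardPencil
import HarnessLib

/-!
# Time reversal of maximal vacuum Cauchy developments (registered stub
`stub_exists_reverse_development`, line `Sketch`, crux `PhotonSphereChannels.TameCensorship`,
item stmt-FinalStateConjecture-17431)

The time-reversal covariance of the vacuum Cauchy problem: if `D' = (h, −k)` pointwise and
`𝒟 = (M, g, T, ι, ν)` is a maximal vacuum Cauchy development of `D = (h, k)`, then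
`(M, g, −T, ι, −ν)` is a maximal vacuum Cauchy development of `D'` whose spacetime is the
time-reversed spacetime `𝒟.toSpacetime.reverse` (`Spacetime.reverse`). Field by field:
`−ν` is the future unit normal of `ι` for `−T` (normality and `g(ν, ν) = −1` are even in `ν`,
`TimeOrientation.isFutureDirected_reverse_iff` / `isFutureDirected_neg_iff`); the induced metric
is unchanged; `K_{−ν} = −K_ν = −k` (`PseudoRiemannianMetric.secondFundamentalForm_const_smul`
with the constant `−1`, O'Neill 1983, Ch. 4, Lemma 4.4); `ι(X)` is a Cauchy hypersurface for
`−T` (`LorentzianMetric.IsCauchyHypersurface.reverse`, O'Neill 1983, Ch. 14, Def. 14.28);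
`Ric(g) = 0` is unchanged. Maximality (Choquet-Bruhat–Geroch 1969; Ringström 2009, Def. 16.5):
a vacuum Cauchy development `𝒟''` of `D'` reverses (the hypotheses are symmetric in `D`, `D'`)
to one of `D`, which embeds into `𝒟` by maximality through some `ψ`; the same `ψ` embeds `𝒟''`
into the reverse of `𝒟` — smoothness, openness, `ψ^* g = g''` and `ψ ∘ ι'' = ι` do not see the
orientation, and `dψ(−T'')` future-directed for `T` is `dψ(T'')` future-directed for `−T`.
The template is `Literature/Geometry/Lorentzian/CauchyDevelopmentConstSmul.lean` (dilation
covariance). The file is definition-free: the reversed developments are anonymous structure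
instances inside the proof. Stub-worker of the line lead
prover-line-stmt-FinalStateConjecture-17431-c3-0, 2026-08-17.
-/

-- the summit-side namespace `Summit.FinalStateConjecture.FinalStateConjecture.…` (summit = problem)
-- repeats a component by design, which the `dupNamespace` linter would flag on every decl.
set_option linter.dupNamespace false

noncomputable section

open Literature.Geometry.Lorentzian
open scoped Manifold ContDiff Topology

namespace Summit.FinalStateConjecture.FinalStateConjecture.Theorems.PhotonSphereChannels.TameCensorshipUnwind

variable {X : Type} [TopologicalSpace X] [ChartedSpace E3 X] [IsManifold (𝓡 3) ∞ X]
  [ConnectedSpace X] {D D' : InitialDataSet (𝓡 3) X}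

/-- `−ν` is the future unit normal of `ι` for the reversed time orientation `−T`: normality is
linear in `ν`, `g(−ν, −ν) = g(ν, ν) = −1`, and `−ν` is future-directed for `−T` iff `ν` is for `T`
(O'Neill 1983, Ch. 4, pp. 106–107; Ch. 5, p. 145). -/
private theorem isFutureUnitNormal_neg_reverse (𝒟 : VacuumCauchyDevelopment D) :
    𝒟.metric.IsFutureUnitNormal (𝓡 3) 𝒟.timeOrientation.reverse 𝒟.embed (-𝒟.normal) := by
  obtain ⟨⟨hn, hu⟩, hf⟩ := 𝒟.isFutureUnitNormal
  refine ⟨⟨fun y v ↦ ?_, fun y ↦ ?_⟩, fun y ↦ ?_⟩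
  · rw [Pi.neg_apply, map_neg, neg_apply, hn y v, neg_zero]
  · rw [Pi.neg_apply, map_neg, map_neg, neg_apply, neg_neg, hu y]
  · rw [Pi.neg_apply, TimeOrientation.isFutureDirected_reverse_iff,
      ← TimeOrientation.isFutureDirected_neg_iff, neg_neg]
    exact hf y

/-- The induced metric does not see the orientation: `ι^* g = h = h'`. -/
private theorem induced_h_of_eq (hh : D'.h = D.h) (𝒟 : VacuumCauchyDevelopment D) (y : X) :
    pullbackBilin (I := 𝓡 (3 + 1)) (I' := 𝓡 3) 𝒟.embed 𝒟.metric.val y = D'.h.inner y := by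
  rw [hh]
  exact 𝒟.induced_h y

/-- `K_{−ν} = −K_ν = −k = k'` (`secondFundamentalForm_const_smul` with the constant `−1`;
O'Neill 1983, Ch. 4, Lemma 4.4). -/
private theorem secondFundamentalForm_neg_eq
    (hk : ∀ (x : X) (v w : TangentSpace (𝓡 3) x), D'.k x v w = -D.k x v w)
    (𝒟 : VacuumCauchyDevelopment D) [𝒟.metric.toPseudoRiemannianMetric.HasLeviCivita] (y : X) :
    𝒟.metric.toPseudoRiemannianMetric.secondFundamentalForm (𝓡 3) 𝒟.embed (-𝒟.normal) y =
      D'.kBilin y := by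
  rw [← neg_one_smul ℝ 𝒟.normal, PseudoRiemannianMetric.secondFundamentalForm_const_smul,
    𝒟.induced_k y]
  refine LinearMap.ext₂ fun v w ↦ ?_
  rw [LinearMap.smul_apply, LinearMap.smul_apply, InitialDataSet.kBilin_apply,
    InitialDataSet.kBilin_apply, hk, smul_eq_mul, neg_one_mul]

/-- **MGHDs reverse** (registered stub `stub_exists_reverse_development` of the line `Sketch` of
the crux `PhotonSphereChannels.TameCensorship`; the time-reversal covariance of the vacuum Cauchy
problem). If `D' = (h, −k)` pointwise and `𝒟 = (M, g, T, ι, ν)` is a maximal vacuum Cauchy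
development of `D`, then `(M, g, −T, ι, −ν)` is a maximal vacuum Cauchy development of `D'` with
spacetime `𝒟.toSpacetime.reverse`: `−ν` is the future unit normal for `−T`
(`isFutureUnitNormal_neg_reverse`); `K_{−ν} = −K_ν = −k` (`secondFundamentalForm_neg_eq`);
`ι(X)` is a Cauchy hypersurface for `−T` (`IsCauchyHypersurface.reverse`); `Ric(g) = 0` is
unchanged. Maximality: a vacuum Cauchy development `𝒟''` of `D'` reverses to one of `D`
(the hypotheses are symmetric), embeds into `𝒟` through some `ψ` by maximality, and the same `ψ`
embeds `𝒟''` into the reverse of `𝒟` (isometric immersion, openness and `ψ ∘ ι'' = ι` unchanged;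
`dψ(−T'')` future for `T` iff `dψ(T'')` future for `−T`: `map_neg`, `isFutureDirected_neg_iff`,
`isFutureDirected_reverse_iff`). O'Neill 1983, Ch. 4, Lemma 4.4; Ch. 14, Def. 14.28;
Choquet-Bruhat–Geroch 1969; Ringström 2009, Def. 16.5. -/
theorem stub_exists_reverse_development :
    ∀ (X : Type) [TopologicalSpace X] [ChartedSpace E3 X] [IsManifold (𝓡 3) ∞ X] [T2Space X]
    [SecondCountableTopology X] [ConnectedSpace X] (D D' : InitialDataSet (𝓡 3) X),
    D'.h = D.h → (∀ (x : X) (v w : TangentSpace (𝓡 3) x), D'.k x v w = -D.k x v w) →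
    ∀ 𝒟 : VacuumCauchyDevelopment D, 𝒟.IsMaximal →
    ∃ 𝒟' : VacuumCauchyDevelopment D', 𝒟'.IsMaximal ∧ 𝒟'.toSpacetime = 𝒟.toSpacetime.reverse := by
  intro X _ _ _ _ _ _ D D' hh hk 𝒟 h𝒟
  -- the symmetric form of the hypotheses, for reversing developments of `D'` back to `D`
  have hh' : D.h = D'.h := hh.symm
  have hk' : ∀ (x : X) (v w : TangentSpace (𝓡 3) x), D.k x v w = -D'.k x v w :=
    fun x v w ↦ by rw [hk, neg_neg]
  refine ⟨{ toSpacetime := 𝒟.toSpacetime.reverse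
            embed := 𝒟.embed
            isSmoothEmbedding := 𝒟.isSmoothEmbedding
            normal := -𝒟.normal
            isFutureUnitNormal := isFutureUnitNormal_neg_reverse 𝒟
            induced_h := induced_h_of_eq hh 𝒟
            induced_k := by
              intro inst y
              haveI : 𝒟.metric.toPseudoRiemannianMetric.HasLeviCivita := inst
              exact secondFundamentalForm_neg_eq hk 𝒟 y
            isCauchyHypersurface := 𝒟.isCauchyHypersurface.reverse
            isRicciFlat := by
              intro inst
              haveI : 𝒟.metric.toPseudoRiemannianMetric.HasLeviCivita := inst
              exact 𝒟.isRicciFlat }, ?_, rfl⟩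
  -- maximality
  intro 𝒟''
  obtain ⟨ψ, hψs, hψo, hψi, hψτ, hψι⟩ :
      ∃ ψ : 𝒟''.carrier → 𝒟.carrier, ContMDiff (𝓡 (3 + 1)) (𝓡 (3 + 1)) ∞ ψ ∧
        Topology.IsOpenEmbedding ψ ∧
        𝒟''.metric.IsIsometricImmersion 𝒟.metric.toPseudoRiemannianMetric ψ ∧
        𝒟''.timeOrientation.reverse.PreservesTimeOrientation ψ 𝒟.timeOrientation ∧
        ψ ∘ 𝒟''.embed = 𝒟.embed := h𝒟
    { toSpacetime := 𝒟''.toSpacetime.reverse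
      embed := 𝒟''.embed
      isSmoothEmbedding := 𝒟''.isSmoothEmbedding
      normal := -𝒟''.normal
      isFutureUnitNormal := isFutureUnitNormal_neg_reverse 𝒟''
      induced_h := induced_h_of_eq hh' 𝒟''
      induced_k := by
        intro inst y
        haveI : 𝒟''.metric.toPseudoRiemannianMetric.HasLeviCivita := inst
        exact secondFundamentalForm_neg_eq hk' 𝒟'' y
      isCauchyHypersurface := 𝒟''.isCauchyHypersurface.reverse
      isRicciFlat := by
        intro inst
        haveI : 𝒟''.metric.toPseudoRiemannianMetric.HasLeviCivita := inst
        exact 𝒟''.isRicciFlat }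
  refine ⟨ψ, hψs, hψo, hψi, fun y ↦ ?_, hψι⟩
  have h1 := hψτ y
  rw [TimeOrientation.vectorField_reverse, map_neg, TimeOrientation.isFutureDirected_neg_iff] at h1
  change 𝒟.timeOrientation.reverse.IsFutureDirected
    (mfderiv (𝓡 (3 + 1)) (𝓡 (3 + 1)) ψ y (𝒟''.timeOrientation.vectorField y))
  rwa [TimeOrientation.isFutureDirected_reverse_iff]

end Summit.FinalStateConjecture.FinalStateConjecture.Theorems.PhotonSphereChannels.TameCensorshipUnwind

end
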